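import Literature.NumberTheory.Transcendental.NesterenkoMultiplicityHeightsGauss
import Literature.NumberTheory.Transcendental.NesterenkoChowFormHypersurfaceK
import HarnessLib

/-!
# Heights over `K = ℂ(z)`: `h((P)) ≤ h(P)` (LNM 1752 Ch. 3 Prop. 4.8 2)) — proofs only

`Literature/NumberTheory/Transcendental/NesterenkoMultiplicityHeightsPrincipal.lean` — proofs only (no
definitions, no named facts). For a non-zero form `P ∈ K[x₀, …, x_m]`, `K = ℂ(z)`, of degree `d ≥ 1`:
`h((P)) ≤ h(P)` for the heights `heightI`, `heightP` of `NesterenkoMultiplicityHeights.lean`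
(`heightI_span_singleton_le`) — the height clause of the field `prop_4_8` of the Ch. 10 hypothesis bundle
`CzToolkit`. The associated form of `(P)` is `c · P(Δ₀, …, Δ_m)` with `c ∈ K^×`
(`NesterenkoK.chowForm_span_singleton`, any field); the signed maximal minors `Δ_j` of the generic matrix
have integer coefficients, so substituting them into a primitive integral representative of `P` does not
raise `deg_z` (`coeffDeg_aeval_maxMinor_le`), and the height is invariant under `K^×`. (Over `ℚ` the book
has `h((P)) ≤ h(P) + m²d`; the correction is archimedean and absent for `ℂ(z)`.)

## References

* [NesterenkoPhilippon2001] Yu. V. Nesterenko, P. Philippon (eds.), *Introduction to Algebraic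
  Independence Theory*, LNM 1752, Springer 2001, Ch. 3 Prop. 4.8 (p. 40); Ch. 10 §2 (p. 152).
-/

noncomputable section

open MvPolynomial
open scoped Polynomial

namespace Literature.NumberTheory.Transcendental

namespace NesterenkoMultiplicity

/-! ## `h((P)) ≤ h(P)`: the height of the Chow form of a principal ideal (Ch. 3 Prop. 4.8 2) over `ℂ(z)`) -/

section Principal

open NesterenkoK

variable {m : ℕ}

/-- The signed maximal minors of the generic matrix over `ℂ[z]` are the base change of those over `ℂ`.
[folklore] -/
theorem maxMinor_mvPolynomialX_polynomial (j : Fin (m + 1)) :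
    Nesterenko.maxMinor (Matrix.mvPolynomialX (Fin m) (Fin (m + 1)) ℂ[X]) j =
      MvPolynomial.map (algebraMap ℂ ℂ[X]) (Nesterenko.maxMinor (Matrix.mvPolynomialX (Fin m) (Fin (m + 1)) ℂ) j) := by
  rw [Nesterenko.map_maxMinor]
  congr 1
  ext i k : 2
  simp [Matrix.mvPolynomialX_apply, map_X]

/-- The signed maximal minors over `K = ℂ(z)` are the base change of those over `ℂ[z]`. [folklore] -/
theorem genDelta_eq_map (j : Fin (m + 1)) :
    genDelta (RatFunc ℂ) m j =
      MvPolynomial.map (algebraMap ℂ[X] (RatFunc ℂ)) (Nesterenko.maxMinor (Matrix.mvPolynomialX (Fin m) (Fin (m + 1)) ℂ[X]) j) := by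
  unfold genDelta
  rw [Nesterenko.map_maxMinor]
  congr 1
  ext i k : 2
  simp [Matrix.mvPolynomialX_apply, map_X]

/-- **Substituting the integral forms `Δ_j` does not raise `deg_z`**: `deg_z E(Δ) ≤ deg_z E`. [folklore] -/
theorem coeffDeg_aeval_maxMinor_le (E : MvPolynomial (Fin (m + 1)) ℂ[X]) :
    coeffDeg (aeval (fun j => Nesterenko.maxMinor (Matrix.mvPolynomialX (Fin m) (Fin (m + 1)) ℂ[X]) j) E) ≤ coeffDeg E := by
  classical
  set Δℂ : Fin (m + 1) → MvPolynomial (Fin m × Fin (m + 1)) ℂ :=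
    fun j => Nesterenko.maxMinor (Matrix.mvPolynomialX (Fin m) (Fin (m + 1)) ℂ) j with hΔℂ
  set φ : MvPolynomial (Fin m × Fin (m + 1)) ℂ →+* MvPolynomial (Fin m × Fin (m + 1)) ℂ[X] :=
    MvPolynomial.map (algebraMap ℂ ℂ[X]) with hφ
  have hΔ : (fun j => Nesterenko.maxMinor (Matrix.mvPolynomialX (Fin m) (Fin (m + 1)) ℂ[X]) j) = fun j => φ (Δℂ j) := by
    funext j; exact maxMinor_mvPolynomialX_polynomial j
  rw [hΔ]
  -- expand `E(Δ)` as a sum over the support of `E`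
  have hrepr : aeval (fun j => φ (Δℂ j)) E =
      ∑ e ∈ E.support, C (E.coeff e) * φ (e.prod fun j k => Δℂ j ^ k) := by
    conv_lhs => rw [E.as_sum]
    rw [map_sum]
    refine Finset.sum_congr rfl fun e _ => ?_
    rw [aeval_monomial, MvPolynomial.algebraMap_eq, map_finsuppProd]
    simp only [map_pow]
  rw [hrepr]
  refine coeffDeg_le_of_forall fun d _ => ?_
  rw [coeff_sum]
  apply Polynomial.natDegree_sum_le_of_forall_le
  intro e he
  rw [coeff_C_mul, hφ, coeff_map]
  exact (Polynomial.natDegree_mul_C_le _ _).trans (natDegree_coeff_le_coeffDeg E e)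

/-- **LNM 1752 Ch. 3 Prop. 4.8 2) over `K = ℂ(z)`: `h((P)) ≤ h(P)`** for a non-zero form `P` of degree
`d ≥ 1` (all places of `ℂ(z)` are non-archimedean: the associated form of `(P)` is `c · P(Δ_0, …, Δ_m)`,
`c ∈ K^×` (`NesterenkoK.chowForm_span_singleton`), and substituting the integral forms `Δ_j` into a
primitive integral representative does not raise `deg_z`). This is the height clause of the toolkit field
`CzToolkit.prop_4_8` for the heights `heightI`, `heightP`. [cite: NesterenkoPhilippon2001, Ch. 3 Prop. 4.8 (p. 40); Ch. 10 §2 (p. 152)] -/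
theorem heightI_span_singleton_le {P : Kx m} {d : ℕ} (hP0 : P ≠ 0) (hP : P.IsHomogeneous d) (hd : 1 ≤ d) :
    heightI (Ideal.span {P}) m ≤ heightP P := by
  classical
  -- a primitive integral representative `E` of `P`: `map E = b P`, `h(P) = deg_z E`
  obtain ⟨c₀, hc₀, E₀, hE₀⟩ := exists_integral_rep P
  have hE₀0 : E₀ ≠ 0 := ne_zero_of_map_eq hP0 hc₀ hE₀
  set E := primPart E₀ with hE
  have hcont : content E₀ ≠ 0 := fun h => hE₀0 ((content_eq_zero_iff E₀).mp h)
  have halg : (algebraMap ℂ[X] (RatFunc ℂ)) (content E₀) ≠ 0 :=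
    (map_ne_zero_iff _ (IsFractionRing.injective ℂ[X] (RatFunc ℂ))).mpr hcont
  set b : RatFunc ℂ := (algebraMap ℂ[X] (RatFunc ℂ) (content E₀))⁻¹ * algebraMap ℂ[X] (RatFunc ℂ) c₀ with hb
  have hb0 : b ≠ 0 := mul_ne_zero (inv_ne_zero halg)
    ((map_ne_zero_iff _ (IsFractionRing.injective ℂ[X] (RatFunc ℂ))).mpr hc₀)
  have hEmap : MvPolynomial.map (algebraMap ℂ[X] (RatFunc ℂ)) E = C b * P := by
    have h1 : MvPolynomial.map (algebraMap ℂ[X] (RatFunc ℂ)) E₀ =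
        C (algebraMap ℂ[X] (RatFunc ℂ) (content E₀)) * MvPolynomial.map (algebraMap ℂ[X] (RatFunc ℂ)) E := by
      conv_lhs => rw [← content_smul_primPart E₀]
      rw [smul_eq_C_mul, map_mul, map_C]
    rw [hb, map_mul C, mul_assoc, ← hE₀, h1, ← mul_assoc, ← map_mul C, inv_mul_cancel₀ halg, C_1, one_mul]
  have hhP : fheight P = coeffDeg E := fheight_eq_of_map_eq hc₀ hE₀
  -- the Chow form of `(P)`
  obtain ⟨c, hc, hcf⟩ := chowForm_span_singleton hP (by omega)
  have hhyper : hyperChow (MvPolynomial.map (algebraMap ℂ[X] (RatFunc ℂ)) E) = C b * hyperChow P := by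
    unfold hyperChow
    rw [hEmap, map_mul, aeval_C, MvPolynomial.algebraMap_eq]
  -- `hyperChow (map E) = map (E(Δ))` with the integral `Δ`
  have hbase : hyperChow (MvPolynomial.map (algebraMap ℂ[X] (RatFunc ℂ)) E) =
      MvPolynomial.map (algebraMap ℂ[X] (RatFunc ℂ))
        (aeval (fun j => Nesterenko.maxMinor (Matrix.mvPolynomialX (Fin m) (Fin (m + 1)) ℂ[X]) j) E) := by
    unfold hyperChow
    have hΔ : genDelta (RatFunc ℂ) m = fun j => MvPolynomial.map (algebraMap ℂ[X] (RatFunc ℂ))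
        (Nesterenko.maxMinor (Matrix.mvPolynomialX (Fin m) (Fin (m + 1)) ℂ[X]) j) := funext genDelta_eq_map
    rw [aeval_eq_bind₁, aeval_eq_bind₁, map_bind₁, hΔ]
  have hchow : chowForm (Ideal.span {P}) m = C (c * b⁻¹) * MvPolynomial.map (algebraMap ℂ[X] (RatFunc ℂ))
      (aeval (fun j => Nesterenko.maxMinor (Matrix.mvPolynomialX (Fin m) (Fin (m + 1)) ℂ[X]) j) E) := by
    rw [hcf, ← hbase, hhyper, map_mul C, mul_assoc, ← mul_assoc (C b⁻¹), ← map_mul C, inv_mul_cancel₀ hb0,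
      C_1, one_mul]
  -- heights
  unfold heightI heightP
  rw [hchow, fheight_C_mul (mul_ne_zero hc (inv_ne_zero hb0)), hhP]
  exact_mod_cast (fheight_map_le _).trans (coeffDeg_aeval_maxMinor_le E)

end Principal

end NesterenkoMultiplicity

end Literature.NumberTheory.Transcendental

end
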